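import Summits.BirchSwinnertonDyer.Rank1Residual.Ordinary.Conjectures.KolyvaginKimDatumOfEulerSystemBadPrimes
import Summits.BirchSwinnertonDyer.Rank1Residual.GaloisImage.TorsionReductionOfLe
import HarnessLib

/-!
# C-16's per-letter clause from an Euler system of `T_3E` with THEOREM D's reduction maps `rd`/`hrd` DISCHARGED
# (companion of `KolyvaginKimDatumOfEulerSystemLetter.lean` (F31b) and `KolyvaginKimDatumOfEulerSystemBadPrimes.lean` (F33);
# theorems only; nothing asserted; C-16 stays a CONJECTURE)

HONEST FRAMING (cell `b2b-bsdres`, run/shared/lean/b2b/bsd-rank1-residual/, verbatim in every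
file): the goal of the cell is to DELETE the COMBINATION-SHAPED residual classes of the
Birch–Swinnerton-Dyer formula for ALL analytic-rank `≤ 1` elliptic curves over `ℚ` — "full BSD
formula for every rank `≤ 1` curve in class `C`" assembled STRICTLY from published theorems — so
that the rank-`≤ 1` remainder becomes exactly the CONSTRUCTION-SHAPED classes, which are TYPED
(missing-input `Prop`s), NOT attempted. This is not "finishing BSD". Seat `b2b-bsdres-additive-p3`
(X8 prover B / X7 joint; typer-designate for the cell conjecture C-16 = hyp C120.1; ladder BSD:K3 hand-off to cell
`bsd-ssimc`; written inside the D-0075 claim window). This file books nothing and moves no mark; X7 / X8 stay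
CONSTRUCTION-SHAPED; C-16 = CONJECTURE. NO Euler system is asserted to exist (binder `hc` inside `h`).

## What this file does

n1011's THEOREM D (`GaloisImage/KolyvaginSystemOfEulerSystemTorsionCoeffThree.lean`, and its `…PropagatedBad` variant) and hence
the chain's per-letter ENDs F31b `kuriharaExactOrderAt_of_isEulerSystem_torsionCoeff_letter` and F33
`kuriharaExactOrderAt_of_isEulerSystem_of_primes''_letter` quantify over a TOWER OF REDUCTION MAPS
`rd j : E[3^{j+1}·3] →ⁱL E[3^j·3]` with `hrd : rd j x = 3 • x` on points (Mazur–Rubin App. A: the maps `T/m^{k+1} → T/m^k`; they feed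
n1011's F11/F12 `propagatedSelmerStructure_three_eq_top_of_torsion_eq_zero`). That tower EXISTS for every curve: n1011-p11's
constructor `GaloisImage.exists_torsionReduction_pow_mul` (`TorsionReductionOfLe.lean`: inclusion into the equal level composed with
`torsionMulBy`) at `(k, k′) = (j, j+1)`, read through `(j+1) − j = 1` — the idiom of n1011's own rows
(`KatoKuriharaPortThreeOfZetaBodyBad.lean`). So:

* §1 `exists_torsionReduction_succ` / `exists_torsionReductionTower` — for every prime `p` (any natural number) and every curve over any
  field, ONE STEP `red : E[p^{j+1}·p] →ⁱL E[p^j·p]` with `red x = p • x`, and the whole tower `rd` with `hrd` (plain choice over `j`);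
* §2 `kuriharaExactOrderAt_of_isEulerSystem_torsionCoeff_letter_canonicalRed` — F31b with `rd`/`hrd` DISCHARGED: the ONLY remaining
  curve-level binder of THEOREM D is `hbad` (`E(ℚ_w)[3] = 0` at the bad `w ≠ 3` — NOT a clause of C-16's letter);
* §3 `kuriharaExactOrderAt_of_isEulerSystem_of_primes''_letter_canonicalRed` — F33 with `rd`/`hrd` DISCHARGED: NO curve-level binder of
  THEOREM D is left — every displayed hypothesis is a clause of C-16's letter (`3` good, `a₃ ∉ {1, −2}`, `m₃(P) = 0`, `ℓ` cyclic,
  surj(3)), one of the two published named facts (Poitou–Tate `I.4.10(b)`, local Euler characteristic `I.2.8`), or part of the per-`ψ`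
  datum «an Euler system of `T_3E` over the cyclotomic levels + THE CANONICAL Kolyvagin datum `∋ vℓ` with the prime-set condition `hP″`
  + the two READINGS of its derivative classes (bottom class; Kim's reading at `v₃`, OPEN at `3`)».

Nothing here is new mathematics: §1 is n1011's constructor re-read at consecutive levels; §2/§3 are F31b/F33 applied to it.
C-16 stays a CONJECTURE; the displayed per-`ψ` datum is exactly what a K3 typer still supplies (hand-off index §2: T1′ Kato's Euler
system as a typed object, T2′ Kim Thm. 3.13 + (5.3) at `3`, T3′ MR Thm. 5.2.12 bottom class).

References: B. Mazur, K. Rubin, Mem. AMS 799 (2004) Thm. 3.2.4, 5.2.12, App. A [MazurRubin2004]; K. Rubin, *Euler Systems* (2000)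
Thm. 4.5.1 [Rubin2000]; C.-H. Kim, arXiv:2203.12159 Thm. 3.13, (5.3) [Kim2022StructureSelmer]; J. S. Milne, ADT (2006) I 2.8,
4.10(b), I §6 [MilneADT2006]; J. H. Silverman, AEC (2009) IV.6.1, VII.2.1 [SilvermanAEC2009].
-/

noncomputable section

open CategoryTheory Function Finset Field IsDedekindDomain
open scoped NumberField Classical ContRepresentation MatrixGroups
open CongruenceSubgroup WeierstrassCurve Literature.NumberTheory.EllipticCurves
  Literature.NumberTheory.EllipticCurves.ModularForms
  Literature.NumberTheory.EllipticCurves.Rank1Residual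
  Literature.NumberTheory.GaloisRepresentations Literature.NumberTheory.GaloisCohomology
  Literature.NumberTheory.GaloisRepresentations.DiscreteGaloisModule
  NumberField
  Summit.BirchSwinnertonDyer.Rank1Residual.GaloisImage
  Summit.BirchSwinnertonDyer.Rank1Residual.GaloisImage.CoeffTransport
  Summit.BirchSwinnertonDyer.Rank1Residual.GaloisImage.CyclotomicLevel
  Summit.BirchSwinnertonDyer.Rank1Residual.GaloisImage.TorsionCoeff
  Rat.HeightOneSpectrum

namespace Summit.BirchSwinnertonDyer.Rank1Residual.Ordinary

/-! ### §1 The reduction tower `E[p^{j+1}·p] → E[p^j·p]`, `x ↦ p·x` (n1011's constructor at consecutive levels) -/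

section Reduction

variable {K : Type} [Field K] (V : WeierstrassCurve K)

/-- **One step of the reduction tower**: for every natural number `p`, every `j` and every Weierstrass curve over any field there is a
continuous `Γ_K`-intertwining map `red : E[p^{j+1}·p] → E[p^j·p]` acting on points as multiplication by `p` — n1011's
`exists_torsionReduction_pow_mul` at `(k, k′) = (j, j+1)`, read through `(j+1) − j = 1`.
[cite: MazurRubin2004, App. A] [folklore] -/
theorem exists_torsionReduction_succ (p j : ℕ) :
    ∃ red : (V.torsionGaloisModule (((p : ℕ) : ℤ) ^ (j + 1) * ((p : ℕ) : ℤ))).toContRepresentation →ⁱL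
        (V.torsionGaloisModule (((p : ℕ) : ℤ) ^ j * ((p : ℕ) : ℤ))).toContRepresentation,
      ∀ x : geomTorsion V (((p : ℕ) : ℤ) ^ (j + 1) * ((p : ℕ) : ℤ)),
        ((red x : geomTorsion V (((p : ℕ) : ℤ) ^ j * ((p : ℕ) : ℤ))) : geomPoints V) =
          ((p : ℕ) : ℤ) • (x : geomPoints V) := by
  obtain ⟨red, hred⟩ := exists_torsionReduction_pow_mul V p j (j + 1)
  refine ⟨red, fun x => ?_⟩
  rw [hred, Nat.add_sub_cancel_left, pow_one]

/-- **The whole reduction tower** `rd j : E[p^{j+1}·p] →ⁱL E[p^j·p]`, `rd j x = p • x` for all `j` — THEOREM D's binders `(rd, hrd)`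
(n1011 `KolyvaginSystemOfEulerSystemTorsionCoeff*`, F11/F12 `propagatedSelmerStructure_three_eq_top_of_torsion_eq_zero`), obtained
from `exists_torsionReduction_succ` by choice over `j`. [cite: MazurRubin2004, App. A] [folklore] -/
theorem exists_torsionReductionTower (p : ℕ) :
    ∃ rd : ∀ j : ℕ, (V.torsionGaloisModule (((p : ℕ) : ℤ) ^ (j + 1) * ((p : ℕ) : ℤ))).toContRepresentation →ⁱL
        (V.torsionGaloisModule (((p : ℕ) : ℤ) ^ j * ((p : ℕ) : ℤ))).toContRepresentation,
      ∀ (j : ℕ) (x : geomTorsion V (((p : ℕ) : ℤ) ^ (j + 1) * ((p : ℕ) : ℤ))),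
        ((rd j x : geomTorsion V (((p : ℕ) : ℤ) ^ j * ((p : ℕ) : ℤ))) : geomPoints V) =
          ((p : ℕ) : ℤ) • (x : geomPoints V) :=
  ⟨fun j => (exists_torsionReduction_succ V p j).choose, fun j => (exists_torsionReduction_succ V p j).choose_spec⟩

end Reduction

variable (W : WeierstrassCurve ℚ) [W.IsElliptic] [W.IsGloballyMinimal]
variable [Module.Free ℤ_[3] (W.tateModule 3)] [Module.Finite ℤ_[3] (W.tateModule 3)]
  [ContinuousSMul ℤ_[3] (W.tateModule 3)]

/-- Local notation: `T∞ = T_3 E` as a continuous `G_ℚ`-representation (as in n1011's THEOREM D files). -/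
local notation3 "T∞" => WeierstrassCurve.tateGaloisRep W 3 (W.continuous_galoisRepTate_holds 3)

/-- Local notation: `𝐃ℤ⟦X, U, τ⟧ ℓ = ∑_{j < ℓ−1} j·(τ_ℓ)_*^j` on `H¹(U, X)` (`ℤ`-linear), Kolyvagin's derivative operator. -/
local notation3 (prettyPrint := false) "𝐃ℤ⟦" X ", " U ", " τ "⟧" =>
  fun ℓ : HeightOneSpectrum (𝓞 ℚ) =>
  ∑ j ∈ Finset.range (((primesEquiv ℓ : Nat.Primes) : ℕ) - 1),
    (j : Module.End ℤ (continuousCohomology 1 (subgroupRep X U))) *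
      (conjMap X U ((τ : HeightOneSpectrum (𝓞 ℚ) → absoluteGaloisGroup ℚ) ℓ) 1).hom.toLinearMap ^ j

/-- Local notation: the level-`j` reduction `red_j : T_3E ⟶ E[3^j]_{ℤ_3}` (n1011 GZ-2). -/
local notation3 "𝐫𝐞𝐝⟦" j "⟧" => tateModuleRed W 3 (W.continuous_galoisRepTate_holds 3) j

variable {N : ℕ} (f : CuspForm (Gamma0 N) 2) (ℓ k₀ : ℕ) [Fact ℓ.Prime] (P : W.toAffine.Point) (F : ℕ)

/-! ### §2 F31b with the reduction tower discharged: remaining curve-level binder `hbad` ONLY -/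

section LetterTorsionCoeff

/-- **C-16's clause at `(ℓ, k₀)` ON ITS LETTER from an Euler system of `T_3E` — F31b's
`kuriharaExactOrderAt_of_isEulerSystem_torsionCoeff_letter` with THEOREM D's reduction tower `rd`/`hrd` DISCHARGED**
(`exists_torsionReductionTower W 3`). The ONLY remaining curve-level binder of THEOREM D is `hbad` (`E(ℚ_w)[3] = 0` at the bad `w ≠ 3`,
NOT a clause of C-16's letter — rows with an anomalous bad place are served by §3 instead); everything else is a clause of the letter,
one of the two published named facts, or the per-`ψ` datum (Euler system + canonical datum + readings). Nothing asserted; C-16 stays a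
CONJECTURE. [cite: MazurRubin2004, Thm. 3.2.4, Thm. 5.2.12 and App. A] [cite: Kim2022StructureSelmer, Thm. 3.13 and (5.3)]
[cite: MilneADT2006, Ch. I, Thm. 4.10(b) and Thm. 2.8] [cite: SilvermanAEC2009, IV.6.1 and Prop. VII.2.1] -/
theorem kuriharaExactOrderAt_of_isEulerSystem_torsionCoeff_letter_canonicalRed
    (hgood : W.HasGoodReductionAtPrime 3) (ha1 : W.frobeniusTrace 3 ≠ 1) (ha2 : W.frobeniusTrace 3 ≠ -2)
    (hm0 : ¬ O5.PointLocallyThreeDivisibleAt W 3 P) (hcycℓ : IsCyclicKolyvaginLevel W 3 ℓ)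
    {vℓ v₃ : HeightOneSpectrum (𝓞 ℚ)} (hvℓ : (ℓ : 𝓞 ℚ) ∈ vℓ.asIdeal) (hv₃ : ((3 : ℕ) : 𝓞 ℚ) ∈ v₃.asIdeal)
    (hPT : poitouTate_sum_localTatePairing_eq_zero ℚ)
    (hEPℓ : localEulerPoincareCharacteristic (vℓ.adicCompletion ℚ))
    (hEP₃ : localEulerPoincareCharacteristic (v₃.adicCompletion ℚ))
    (hsurj : W.HasSurjectiveModNGaloisRep ((3 : ℕ) : ℤ))
    -- THEOREM D's ONLY remaining curve-level certificate (NOT a clause of C-16's letter)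
    (hbad : ∀ w : HeightOneSpectrum (𝓞 ℚ), ¬ W.HasGoodReductionAt w →
      ((primesEquiv w : Nat.Primes) : ℕ) ≠ 3 →
        ∀ P : (W.baseChange (w.adicCompletion ℚ)).toAffine.Point, 3 • P = 0 → P = 0)
    -- per surjective `ψ`: the depth, the unit, the Euler system, the canonical datum, the readings
    (h : ∀ ψ : (q : ℕ) → (ZMod q)ˣ →* Multiplicative (ZMod (3 ^ k₀)),
      (∀ q ∈ ℓ.primeFactors, Function.Surjective (ψ q)) →
        ∃ (k : ℕ) (_ : k₀ ≤ k + 1) (_ : Kato.IsKolyvaginPrime W 3 (k + 1) ℓ) (u : ℕ) (_ : ¬ 3 ∣ u)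
          (S : Set (HeightOneSpectrum (𝓞 ℚ)))
          (c : ∀ (i : ℕ) (r : (cyclotomicLevelsRat 3 S).Ideals), H1 T∞ ((cyclotomicLevelsRat 3 S).level i r.1))
          (_ : IsEulerSystem (cyclotomicLevelsRat 3 S) T∞ 3 c)
          (D : KolyvaginDatum (W.torsionGaloisModule (((3 : ℕ) : ℤ) ^ k * ((3 : ℕ) : ℤ))))
          (_ : D.transverse = cyclotomicTransverse (W.torsionGaloisModule (((3 : ℕ) : ℤ) ^ k * ((3 : ℕ) : ℤ))))
          (η : (q : HeightOneSpectrum (𝓞 ℚ)) → (ZMod (Ideal.absNorm q.asIdeal))ˣ)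
          (_ : D.HasCanonicalComparison (3 ^ (k + 1)) η)
          (hPr : D.primes ⊆ (cyclotomicLevelsRat 3 S).primes)
          (_ : ∀ q ∈ D.primes, Kato.IsKolyvaginPrime W 3 (k + 1) ((primesEquiv q : Nat.Primes) : ℕ))
          (Sτ : Set (HeightOneSpectrum (𝓞 ℚ))) (τ : absoluteGaloisGroup ℚ)
          (_ : Nonempty (cokerSubOne (W.torsionGaloisModule (((3 : ℕ) : ℤ) ^ k * ((3 : ℕ) : ℤ))) τ ≃+
            ZMod (3 ^ (k + 1))))
          (_ : τ ∈ rootsOfUnityFixer ℚ (3 ^ (k + 1)))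
          (_ : D.primes ⊆ frobeniusClassPrimes (W.torsionGaloisModule (((3 : ℕ) : ℤ) ^ k * ((3 : ℕ) : ℤ))) Sτ τ
            (3 ^ (k + 1)))
          (_ : vℓ ∈ D.primes)
          (hdiv : ∀ X : geomPoints W, ∃ R : geomPoints W, (((3 : ℕ) : ℤ) ^ k * ((3 : ℕ) : ℤ)) • R = X),
          (letI := TorsionCoeff.torsionBy.padicIntModule 3 (k + 1) (WeierstrassCurve.geomPoints W)
            ∀ (σ : HeightOneSpectrum (𝓞 ℚ) → absoluteGaloisGroup ℚ)
              (Φ : ∀ r : Finset (HeightOneSpectrum (𝓞 ℚ)),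
                continuousCohomology 1 (subgroupRep (torsionRepPadicInt W 3 (k + 1)).toTopRep
                  ((cyclotomicLevelsRat 3 S).level ⊥ r)) →+
                  continuousCohomology 1 (subgroupRep
                    (W.torsionGaloisModule (((3 : ℕ) : ℤ) ^ k * ((3 : ℕ) : ℤ))).toTopRep
                    ((cyclotomicLevelsRat 3 S).level ⊥ r)))
              (comm : ∀ r : Finset (HeightOneSpectrum (𝓞 ℚ)),
                ((r : Finset _) : Set (HeightOneSpectrum (𝓞 ℚ))).Pairwise fun a b =>
                  Commute
                    (𝐃ℤ⟦(W.torsionGaloisModule (((3 : ℕ) : ℤ) ^ k * ((3 : ℕ) : ℤ))).toTopRep,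
                      ((cyclotomicLevelsRat 3 S).level ⊥ r), σ⟧ a)
                    (𝐃ℤ⟦(W.torsionGaloisModule (((3 : ℕ) : ℤ) ^ k * ((3 : ℕ) : ℤ))).toTopRep,
                      ((cyclotomicLevelsRat 3 S).level ⊥ r), σ⟧ b))
              (κ : Finset (HeightOneSpectrum (𝓞 ℚ)) →
                galoisCohomology (W.torsionGaloisModule (((3 : ℕ) : ℤ) ^ k * ((3 : ℕ) : ℤ))) 1),
              (∀ q, σ q ∈ (adicCompletionPrime ℚ q).inertia (absoluteGaloisGroup ℚ)) →
              (∀ q, modNCyclotomicCharacter ℚ (Ideal.absNorm q.asIdeal) (σ q) = η q) →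
              (∀ r, ∀ (φ : contOneCocycles (subgroupRep (torsionRepPadicInt W 3 (k + 1)).toTopRep
                  ((cyclotomicLevelsRat 3 S).level ⊥ r)))
                (ψ' : contOneCocycles (subgroupRep
                  (W.torsionGaloisModule (((3 : ℕ) : ℤ) ^ k * ((3 : ℕ) : ℤ))).toTopRep
                  ((cyclotomicLevelsRat 3 S).level ⊥ r))),
                (∀ g, ψ'.1 g = AddSubgroup.inclusion (geomTorsion_pow_succ_eq W 3 k).le (φ.1 g)) →
                  Φ r (oneCocycleClass _ φ) = oneCocycleClass _ ψ') →
              D.IsKolyvaginSystem (propagatedSelmerStructure W 3 k) κ →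
              (∀ r : Finset (HeightOneSpectrum (𝓞 ℚ)), ¬ (↑r : Set _) ⊆ D.primes → κ r = 0) →
              (∀ (r : Finset (HeightOneSpectrum (𝓞 ℚ))) (hr : (↑r : Set _) ⊆ D.primes),
                resSubgroup (W.torsionGaloisModule (((3 : ℕ) : ℤ) ^ k * ((3 : ℕ) : ℤ))).toTopRep
                    ((cyclotomicLevelsRat 3 S).level ⊥ r) 1 (κ r) =
                  (r.noncommProd 𝐃ℤ⟦(W.torsionGaloisModule (((3 : ℕ) : ℤ) ^ k * ((3 : ℕ) : ℤ))).toTopRep,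
                      ((cyclotomicLevelsRat 3 S).level ⊥ r), σ⟧ (comm r))
                    (Φ r (ContinuousCohomology.map (ContinuousMonoidHom.id _)
                      (X := subgroupRep T∞.toTopRep ((cyclotomicLevelsRat 3 S).level ⊥ r))
                      (Y := subgroupRep (torsionRepPadicInt W 3 (k + 1)).toTopRep
                        ((cyclotomicLevelsRat 3 S).level ⊥ r))
                      ((TopRep.resFunctor ((cyclotomicLevelsRat 3 S).level ⊥ r).subtype).map 𝐫𝐞𝐝⟦k + 1⟧) 1
                      (c ⊥ ⟨r, fun _ hq => hPr (hr (Finset.mem_coe.2 hq))⟩)))) →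
              κ ∅ = kummerMapTorsion W (((3 : ℕ) : ℤ) ^ k * ((3 : ℕ) : ℤ)) hdiv ((3 ^ F * u) • P) ∧
              ∀ ψp : galoisCohomology ((W.torsionGaloisModule (((3 : ℕ) : ℤ) ^ k * ((3 : ℕ) : ℤ))).toLocal
                    (Sum.inr v₃)) 1 ⧸
                  W.kummerSelmerStructure (((3 : ℕ) : ℤ) ^ k * ((3 : ℕ) : ℤ)) (Sum.inr v₃) ≃+ ZMod (3 ^ (k + 1)),
                (haveI : NeZero ℓ := ⟨(Fact.out : ℓ.Prime).ne_zero⟩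
                 zmodPowOrd 3 k₀ (kuriharaNumber f (3 ^ k₀) ℓ ψ)) =
                  min k₀ (zmodPowOrd 3 (k + 1)
                    (ψp (galoisCohomology.localization (W.torsionGaloisModule (((3 : ℕ) : ℤ) ^ k * ((3 : ℕ) : ℤ)))
                      (Sum.inr v₃) 1 (κ {vℓ})))))) :
    KuriharaExactOrderAt W f ℓ k₀ P F := by
  obtain ⟨rd, hrd⟩ := exists_torsionReductionTower W 3
  exact kuriharaExactOrderAt_of_isEulerSystem_torsionCoeff_letter W f ℓ k₀ P F hgood ha1 ha2 hm0 hcycℓ hvℓ hv₃ hPT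
    hEPℓ hEP₃ hsurj hbad rd hrd h

end LetterTorsionCoeff

/-! ### §3 F33 with the reduction tower discharged: NO curve-level binder of THEOREM D left -/

section LetterPrimes

/-- **C-16's clause at `(ℓ, k₀)` ON ITS LETTER from an Euler system of `T_3E`, rows WITH anomalous bad places — F33's
`kuriharaExactOrderAt_of_isEulerSystem_of_primes''_letter` with THEOREM D's reduction tower `rd`/`hrd` DISCHARGED**
(`exists_torsionReductionTower W 3`). NO curve-level binder of THEOREM D is left: every displayed hypothesis is a clause of C-16's
letter (`3` good, `a₃ ∉ {1, −2}`, `m₃(P) = 0`, `ℓ` cyclic, surj(3)), one of the two published named facts (Poitou–Tate, local Euler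
characteristic), or the per-`ψ` datum «an Euler system of `T_3E` over the cyclotomic levels + THE CANONICAL Kolyvagin datum `∋ vℓ`
with the prime-set condition `hP″` (`3 ∤ ord(w mod q)` for `q ∈ 𝒫` and anomalous bad `w`) + the two readings of its derivative classes».
With §2 this covers every curve on C-16's letter. Nothing asserted; C-16 stays a CONJECTURE (a CLOSED sentence would still need `hP″`
folded into the letter — not claimed). [cite: MazurRubin2004, Thm. 3.2.4, Thm. 5.2.12 and App. A] [cite: Rubin2000, Thm. 4.5.1]
[cite: Kim2022StructureSelmer, Thm. 3.13 and (5.3)] [cite: MilneADT2006, Ch. I, Thm. 4.10(b) and Thm. 2.8]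
[cite: SilvermanAEC2009, IV.6.1 and Prop. VII.2.1] -/
theorem kuriharaExactOrderAt_of_isEulerSystem_of_primes''_letter_canonicalRed
    (hgood : W.HasGoodReductionAtPrime 3) (ha1 : W.frobeniusTrace 3 ≠ 1) (ha2 : W.frobeniusTrace 3 ≠ -2)
    (hm0 : ¬ O5.PointLocallyThreeDivisibleAt W 3 P) (hcycℓ : IsCyclicKolyvaginLevel W 3 ℓ)
    {vℓ v₃ : HeightOneSpectrum (𝓞 ℚ)} (hvℓ : (ℓ : 𝓞 ℚ) ∈ vℓ.asIdeal) (hv₃ : ((3 : ℕ) : 𝓞 ℚ) ∈ v₃.asIdeal)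
    (hPT : poitouTate_sum_localTatePairing_eq_zero ℚ)
    (hEPℓ : localEulerPoincareCharacteristic (vℓ.adicCompletion ℚ))
    (hEP₃ : localEulerPoincareCharacteristic (v₃.adicCompletion ℚ))
    (hsurj : W.HasSurjectiveModNGaloisRep ((3 : ℕ) : ℤ))
    -- per surjective `ψ`: the depth, the unit, the Euler system, the canonical datum (with `hP″`), the readings
    (h : ∀ ψ : (q : ℕ) → (ZMod q)ˣ →* Multiplicative (ZMod (3 ^ k₀)),
      (∀ q ∈ ℓ.primeFactors, Function.Surjective (ψ q)) →
        ∃ (k : ℕ) (_ : k₀ ≤ k + 1) (_ : Kato.IsKolyvaginPrime W 3 (k + 1) ℓ) (u : ℕ) (_ : ¬ 3 ∣ u)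
          (S : Set (HeightOneSpectrum (𝓞 ℚ)))
          (c : ∀ (i : ℕ) (r : (cyclotomicLevelsRat 3 S).Ideals), H1 T∞ ((cyclotomicLevelsRat 3 S).level i r.1))
          (_ : IsEulerSystem (cyclotomicLevelsRat 3 S) T∞ 3 c)
          (D : KolyvaginDatum (W.torsionGaloisModule (((3 : ℕ) : ℤ) ^ k * ((3 : ℕ) : ℤ))))
          (_ : D.transverse = cyclotomicTransverse (W.torsionGaloisModule (((3 : ℕ) : ℤ) ^ k * ((3 : ℕ) : ℤ))))
          (η : (q : HeightOneSpectrum (𝓞 ℚ)) → (ZMod (Ideal.absNorm q.asIdeal))ˣ)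
          (_ : D.HasCanonicalComparison (3 ^ (k + 1)) η)
          (hPr : D.primes ⊆ (cyclotomicLevelsRat 3 S).primes)
          (_ : ∀ q ∈ D.primes, Kato.IsKolyvaginPrime W 3 (k + 1) ((primesEquiv q : Nat.Primes) : ℕ))
          (_ : ∀ q ∈ D.primes, ∀ w : HeightOneSpectrum (𝓞 ℚ), ¬ W.HasGoodReductionAt w →
            ((primesEquiv w : Nat.Primes) : ℕ) ≠ 3 →
            (∃ P : (W.baseChange (w.adicCompletion ℚ)).toAffine.Point, 3 • P = 0 ∧ P ≠ 0) →
              ¬ 3 ∣ orderOf ((((primesEquiv w : Nat.Primes) : ℕ) : ZMod ((primesEquiv q : Nat.Primes) : ℕ))))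
          (Sτ : Set (HeightOneSpectrum (𝓞 ℚ))) (τ : absoluteGaloisGroup ℚ)
          (_ : Nonempty (cokerSubOne (W.torsionGaloisModule (((3 : ℕ) : ℤ) ^ k * ((3 : ℕ) : ℤ))) τ ≃+
            ZMod (3 ^ (k + 1))))
          (_ : τ ∈ rootsOfUnityFixer ℚ (3 ^ (k + 1)))
          (_ : D.primes ⊆ frobeniusClassPrimes (W.torsionGaloisModule (((3 : ℕ) : ℤ) ^ k * ((3 : ℕ) : ℤ))) Sτ τ
            (3 ^ (k + 1)))
          (_ : vℓ ∈ D.primes)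
          (hdiv : ∀ X : geomPoints W, ∃ R : geomPoints W, (((3 : ℕ) : ℤ) ^ k * ((3 : ℕ) : ℤ)) • R = X),
          (letI := TorsionCoeff.torsionBy.padicIntModule 3 (k + 1) (WeierstrassCurve.geomPoints W)
            ∀ (σ : HeightOneSpectrum (𝓞 ℚ) → absoluteGaloisGroup ℚ)
              (Φ : ∀ r : Finset (HeightOneSpectrum (𝓞 ℚ)),
                continuousCohomology 1 (subgroupRep (torsionRepPadicInt W 3 (k + 1)).toTopRep
                  ((cyclotomicLevelsRat 3 S).level ⊥ r)) →+
                  continuousCohomology 1 (subgroupRep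
                    (W.torsionGaloisModule (((3 : ℕ) : ℤ) ^ k * ((3 : ℕ) : ℤ))).toTopRep
                    ((cyclotomicLevelsRat 3 S).level ⊥ r)))
              (comm : ∀ r : Finset (HeightOneSpectrum (𝓞 ℚ)),
                ((r : Finset _) : Set (HeightOneSpectrum (𝓞 ℚ))).Pairwise fun a b =>
                  Commute
                    (𝐃ℤ⟦(W.torsionGaloisModule (((3 : ℕ) : ℤ) ^ k * ((3 : ℕ) : ℤ))).toTopRep,
                      ((cyclotomicLevelsRat 3 S).level ⊥ r), σ⟧ a)
                    (𝐃ℤ⟦(W.torsionGaloisModule (((3 : ℕ) : ℤ) ^ k * ((3 : ℕ) : ℤ))).toTopRep,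
                      ((cyclotomicLevelsRat 3 S).level ⊥ r), σ⟧ b))
              (κ : Finset (HeightOneSpectrum (𝓞 ℚ)) →
                galoisCohomology (W.torsionGaloisModule (((3 : ℕ) : ℤ) ^ k * ((3 : ℕ) : ℤ))) 1),
              (∀ q, σ q ∈ (adicCompletionPrime ℚ q).inertia (absoluteGaloisGroup ℚ)) →
              (∀ q, modNCyclotomicCharacter ℚ (Ideal.absNorm q.asIdeal) (σ q) = η q) →
              (∀ r, ∀ (φ : contOneCocycles (subgroupRep (torsionRepPadicInt W 3 (k + 1)).toTopRep
                  ((cyclotomicLevelsRat 3 S).level ⊥ r)))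
                (ψ' : contOneCocycles (subgroupRep
                  (W.torsionGaloisModule (((3 : ℕ) : ℤ) ^ k * ((3 : ℕ) : ℤ))).toTopRep
                  ((cyclotomicLevelsRat 3 S).level ⊥ r))),
                (∀ g, ψ'.1 g = AddSubgroup.inclusion (geomTorsion_pow_succ_eq W 3 k).le (φ.1 g)) →
                  Φ r (oneCocycleClass _ φ) = oneCocycleClass _ ψ') →
              D.IsKolyvaginSystem (propagatedSelmerStructure W 3 k) κ →
              (∀ r : Finset (HeightOneSpectrum (𝓞 ℚ)), ¬ (↑r : Set _) ⊆ D.primes → κ r = 0) →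
              (∀ (r : Finset (HeightOneSpectrum (𝓞 ℚ))) (hr : (↑r : Set _) ⊆ D.primes),
                resSubgroup (W.torsionGaloisModule (((3 : ℕ) : ℤ) ^ k * ((3 : ℕ) : ℤ))).toTopRep
                    ((cyclotomicLevelsRat 3 S).level ⊥ r) 1 (κ r) =
                  (r.noncommProd 𝐃ℤ⟦(W.torsionGaloisModule (((3 : ℕ) : ℤ) ^ k * ((3 : ℕ) : ℤ))).toTopRep,
                      ((cyclotomicLevelsRat 3 S).level ⊥ r), σ⟧ (comm r))
                    (Φ r (ContinuousCohomology.map (ContinuousMonoidHom.id _)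
                      (X := subgroupRep T∞.toTopRep ((cyclotomicLevelsRat 3 S).level ⊥ r))
                      (Y := subgroupRep (torsionRepPadicInt W 3 (k + 1)).toTopRep
                        ((cyclotomicLevelsRat 3 S).level ⊥ r))
                      ((TopRep.resFunctor ((cyclotomicLevelsRat 3 S).level ⊥ r).subtype).map 𝐫𝐞𝐝⟦k + 1⟧) 1
                      (c ⊥ ⟨r, fun _ hq => hPr (hr (Finset.mem_coe.2 hq))⟩)))) →
              κ ∅ = kummerMapTorsion W (((3 : ℕ) : ℤ) ^ k * ((3 : ℕ) : ℤ)) hdiv ((3 ^ F * u) • P) ∧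
              ∀ ψp : galoisCohomology ((W.torsionGaloisModule (((3 : ℕ) : ℤ) ^ k * ((3 : ℕ) : ℤ))).toLocal
                    (Sum.inr v₃)) 1 ⧸
                  W.kummerSelmerStructure (((3 : ℕ) : ℤ) ^ k * ((3 : ℕ) : ℤ)) (Sum.inr v₃) ≃+ ZMod (3 ^ (k + 1)),
                (haveI : NeZero ℓ := ⟨(Fact.out : ℓ.Prime).ne_zero⟩
                 zmodPowOrd 3 k₀ (kuriharaNumber f (3 ^ k₀) ℓ ψ)) =
                  min k₀ (zmodPowOrd 3 (k + 1)
                    (ψp (galoisCohomology.localization (W.torsionGaloisModule (((3 : ℕ) : ℤ) ^ k * ((3 : ℕ) : ℤ)))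
                      (Sum.inr v₃) 1 (κ {vℓ})))))) :
    KuriharaExactOrderAt W f ℓ k₀ P F := by
  obtain ⟨rd, hrd⟩ := exists_torsionReductionTower W 3
  exact kuriharaExactOrderAt_of_isEulerSystem_of_primes''_letter W f ℓ k₀ P F hgood ha1 ha2 hm0 hcycℓ hvℓ hv₃ hPT
    hEPℓ hEP₃ hsurj rd hrd h

end LetterPrimes

end Summit.BirchSwinnertonDyer.Rank1Residual.Ordinary

end
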